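import Summits.BirchSwinnertonDyer.BirchSwinnertonDyer.Theorems.PrintCf2SplitBadEisensteinTwoAtomsRoad
import HarnessLib

/-!
# Crux `PrintCf2.SplitBadTwoRankOneOfFacts` (item 20368), line `eisenstein_two_bdp_line` (skeleton v7 40d712da) — the `τ = 0` row kernel
# WITHOUT a torsion stub: on the atoms road `Λ`-torsion of `X_(∅,0)` is carried by the control socket itself

Cell `bsd-print-cf2`, seat `bsd-line-cf2-p1-w2` g4 (prover, width seat on crux stmt-BirchSwinnertonDyer-20368; lead `bsd-line-cf2-p1` g6).
`--supports stmt-BirchSwinnertonDyer-20368` (helper). Theses-free; THEOREMS ONLY (0 definitions, 0 named facts, 0 `sorry`); CONDITIONAL on every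
displayed hypothesis. BSD is proved for no curve by any of this; nothing registered is negated; no summit statement is proved by this seat.

WHAT THIS IS. Sequel of `PrintCf2SplitBadEisensteinTwoAtomsRoad` (the `τ = 0` row kernel of reshape B: halved Castella frame `2·Q̃`, ♭-IMC equality
against `Q̃`, the odd-`p` control socket `SchneiderFree.AdditiveControlOnTreeAt 2` verbatim). There the torsion stub `hTor` (= registered
`stub_torsion_two`) was still a hypothesis. It is REDUNDANT: the route calls the socket at the Friedberg–Hoffstein field, and the socket's
`XAc.HasCharValuationAt (W.baseChange K) 2 κ 𝔭′ ∅ γ n` has `Module.IsTorsion (IwasawaAlgebra 2) (XAc …)` as its first conjunct — exactly what the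
halved ♭-IMC equality consumes at that frame (-w2 g3 POSTSCRIPT 09:59Z, made precise). Hence:
* §5 **`bsdp_two_of_halvedIMCEq_of_socket_of_twist`** — the row kernel with `hTor` removed (control invoked first, torsion := `hn.1`);
* §6 **`descent_two_of_socket`** — the class-wide form: granted «PRINTS(2)» + Milne + the class-wide socket, HALVED frames ∧ HALVED ♭-IMC
  equality ∧ twin `BSD₂` ⟹ `BSDp W 2`. Reshape B therefore needs FIVE stubs: prints / halved frame / halved inclusion / halved match / socket
  (the socket ⟸ two torsion-finiteness atoms + Poitou–Tate by the lead g6's control-at-2 file; Brink at `2` = p624809).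

References: [JetchevSkinnerWan2017] Thm. 3.3.1 (shape); [Castella2018] Thm. 2.3; [Milne1972ArithmeticAV] §1 Thm. 1; [FriedbergHoffstein1995] Thm. B.
-/

set_option autoImplicit false

-- D-0017 layout: summit = sub-problem, so `Summit.BirchSwinnertonDyer.BirchSwinnertonDyer.…` is the mandated namespace of Theorems files.
set_option linter.dupNamespace false

noncomputable section

open scoped Classical MatrixGroups ModularForm Topology NumberField

namespace Summit.BirchSwinnertonDyer.BirchSwinnertonDyer.Theorems.PrintCf2.EisensteinTwo

open Filter CongruenceSubgroup WeierstrassCurve NumberField IsDedekindDomain Field PowerSeries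
  Literature.NumberTheory.EllipticCurves Literature.NumberTheory.EllipticCurves.ModularForms
  Literature.NumberTheory.EllipticCurves.LiuZhangZhang2018 Literature.NumberTheory.EllipticCurves.Rank1Residual
  Literature.NumberTheory.EllipticCurves.Rank1Residual.Typed Literature.NumberTheory.EllipticCurves.KrizLi2019
  Literature.NumberTheory.GaloisRepresentations Literature.NumberTheory.GaloisCohomology
  Summit.BirchSwinnertonDyer.Rank1Residual Summit.BirchSwinnertonDyer.Rank1Residual.X11b
  Summit.BirchSwinnertonDyer.Rank1Residual.X11b.AcSelmer Summit.BirchSwinnertonDyer.Rank1Residual.X11b.CongruenceLimit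
  Summit.BirchSwinnertonDyer.Rank1Residual.X11b.Halves Summit.BirchSwinnertonDyer.Rank1Residual.X2
  Summit.BirchSwinnertonDyer.Rank1Residual.Additive
  Summit.BirchSwinnertonDyer.BirchSwinnertonDyer.Theses.UniversalToricDescent
  Summit.BirchSwinnertonDyer.BirchSwinnertonDyer.Theorems.UniversalToricDescentWaldspurgerFlat

/-! ### §5 Torsion is free on the atoms road: the socket's `HasCharValuationAt` carries `Λ`-torsion -/

/-- **The `τ = 0` row kernel WITHOUT a torsion hypothesis (torsion is FREE on the atoms road).** Same as
`bsdp_two_of_halvedIMCEq_of_controlZero_of_twist` with `hTor` REMOVED: the route invokes the control socket at the Friedberg–Hoffstein field FIRST;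
its `XAc.HasCharValuationAt (W.baseChange K) 2 κ 𝔭′ ∅ γ n` has `Module.IsTorsion (IwasawaAlgebra 2) (XAc …)` as first conjunct, which is exactly
the torsion hypothesis the halved ♭-IMC equality `hEq` consumes at that frame. So on reshape B the registered `stub_torsion_two` is REDUNDANT
(-w2 g3 POSTSCRIPT 09:59Z made precise in the kernel): stubs = prints / halved frame / halved inclusion / halved match / socket (the socket ⟸ two
torsion-finiteness atoms + Poitou–Tate, lead g6). [cite: Castella2018, Thm. 2.3 (arXiv:1704.06608 p. 5) (shape)]
[cite: JetchevSkinnerWan2017, Thm. 3.3.1 (shape)] [cite: Milne1972ArithmeticAV, §1 Thm. 1] [cite: FriedbergHoffstein1995, Thm. B] -/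
theorem bsdp_two_of_halvedIMCEq_of_socket_of_twist
    (hF : ToricPublishedInputs) (hL : thm151_thm153_modularCurve_heegnerVector_additive)
    (hMilne : Milne1972.bsdQuotient_baseChange_quadratic)
    (W : WeierstrassCurve ℚ) [W.IsElliptic] [W.IsGloballyMinimal] (h4N : 2 ^ 2 ∣ W.conductorNorm ℤ) (hr : W.analyticRank = 1)
    (hFr : ∀ (N : ℕ) [NeZero N] (K : Type) [Field K] [NumberField K] (Dt : ModularParametrizationData W N),
      W.conductorNorm ℤ = N → IsImaginaryQuadratic K → SatisfiesHeegnerHypothesis N K →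
      ∀ (κ : ZpExtension K 2), κ.IsAnticyclotomic → ∀ (γ : Field.absoluteGaloisGroup K) [Fact (κ.IsTopGenerator γ)]
        (𝔭 : HeightOneSpectrum (𝓞 K)), ((2 : ℕ) : 𝓞 K) ∈ 𝔭.asIdeal → 𝔭.asIdeal.ramificationIdx (𝓞 ℚ) = 1 →
        𝔭.asIdeal.inertiaDeg (𝓞 ℚ) = 1 → ∀ (ι' : PadicAlgCl 2 ≃+* ℂ), SchneiderFree.BranchInducesPrime 2 ι' 𝔭 →
        ∃ (ΩK : ℂ) (Ωp : ℂ_[2]) (Qh : PowerSeries (PadicComplexInt 2)),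
          ΩK ≠ 0 ∧ Ωp ≠ 0 ∧ R1.IsBDPLFunctionInt 2 ι' 𝔭 κ γ Dt.f ΩK Ωp (2 * Qh))
    (hEq : ∀ (N : ℕ) [NeZero N] (K : Type) [Field K] [NumberField K] (Dt : ModularParametrizationData W N),
      W.conductorNorm ℤ = N → IsImaginaryQuadratic K → SatisfiesHeegnerHypothesis N K →
      ∀ (κ : ZpExtension K 2), κ.IsAnticyclotomic → ∀ (γ : Field.absoluteGaloisGroup K) [Fact (κ.IsTopGenerator γ)]
        (𝔭 : HeightOneSpectrum (𝓞 K)), ((2 : ℕ) : 𝓞 K) ∈ 𝔭.asIdeal → 𝔭.asIdeal.ramificationIdx (𝓞 ℚ) = 1 →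
        𝔭.asIdeal.inertiaDeg (𝓞 ℚ) = 1 → ∀ (𝔭' : HeightOneSpectrum (𝓞 K)), ((2 : ℕ) : 𝓞 K) ∈ 𝔭'.asIdeal → 𝔭' ≠ 𝔭 →
        ∀ (ι' : PadicAlgCl 2 ≃+* ℂ), SchneiderFree.BranchInducesPrime 2 ι' 𝔭 →
        ∀ (ΩK : ℂ) (Ωp : ℂ_[2]) (Qh : PowerSeries (PadicComplexInt 2)), ΩK ≠ 0 → Ωp ≠ 0 →
          R1.IsBDPLFunctionInt 2 ι' 𝔭 κ γ Dt.f ΩK Ωp (2 * Qh) →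
          Module.IsTorsion (IwasawaAlgebra 2) (XAc (W.baseChange K) 2 κ 𝔭' ∅ γ) →
          (XAc.charIdeal (W.baseChange K) 2 κ 𝔭' ∅ γ).map (PowerSeries.map (R1.toCpInt 2)) = Ideal.span {Qh})
    (hTw : ∀ (N : ℕ) [NeZero N] (K : Type) [Field K] [NumberField K]
      (Wd : WeierstrassCurve ℚ) [Wd.IsElliptic] [Wd.IsGloballyMinimal],
      W.conductorNorm ℤ = N → IsImaginaryQuadratic K → SatisfiesHeegnerHypothesis N K →
      (∃ C : VariableChange ℚ, C • W.quadraticTwist (NumberField.discr K : ℚ) = Wd) →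
      (W.quadraticTwist (NumberField.discr K : ℚ)).entireLFunction 1 ≠ 0 → BSDp Wd 2)
    (hCtl₀ : ∀ (N : ℕ) [NeZero N] (K : Type) [Field K] [NumberField K] (Dt : ModularParametrizationData W N)
      (H : HeegnerDatum N (NumberField.discr K)) (ι : K →+* ℂ) (P : (W.baseChange K).toAffine.Point),
      W.conductorNorm ℤ = N → IsImaginaryQuadratic K → SatisfiesHeegnerHypothesis N K →
      (W.quadraticTwist (NumberField.discr K : ℚ)).entireLFunction 1 ≠ 0 →
      WeierstrassCurve.Affine.Point.map ι.toRatAlgHom P = heegnerPointComplex Dt H → ¬ IsOfFinAddOrder P →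
      Literature.NumberTheory.EllipticCurves.kolyvagin N W K →
      ∀ (κ : ZpExtension K 2), κ.IsAnticyclotomic → ∀ (γ : Field.absoluteGaloisGroup K) [Fact (κ.IsTopGenerator γ)]
        (𝔭 : HeightOneSpectrum (𝓞 K)) (h𝔭 : ((2 : ℕ) : 𝓞 K) ∈ 𝔭.asIdeal) (he : 𝔭.asIdeal.ramificationIdx (𝓞 ℚ) = 1)
        (hf : 𝔭.asIdeal.inertiaDeg (𝓞 ℚ) = 1),
        SchneiderFree.AdditiveControlOnTreeAt 2 κ 𝔭 γ (embAt K 2 𝔭 h𝔭 he hf) P) :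
    BSDp W 2 := by
  obtain ⟨hGZ, hKo, hGZK, hmod, hmodP, -, hGZ73, hFH, hpar, hHP⟩ := hF
  haveI hN0 : NeZero (W.conductorNorm ℤ) := ⟨W.conductorNorm_pos_holds.ne'⟩
  ------------------------------------------------------------------ parity and the Friedberg–Hoffstein field (modulus `6`)
  have hw : W.rootNumber = -1 := by
    rcases W.rootNumber_eq_one_or with h | h
    · exfalso
      have heven : Even W.analyticRank := (hpar W).mpr h
      rw [hr] at heven
      exact Nat.not_even_one heven
    · exact h
  obtain ⟨K, _, _, hK, -, hHN, hH6, hLt⟩ := hFH W hw 6 (by norm_num) 0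
  have hd4 : NumberField.discr K < -4 :=
    discr_lt_neg_four_of_three_split hK (hH6 3 Nat.prime_three (by norm_num : (3 : ℕ) ∣ 6))
  have hw2 : Units.torsionOrder K = 2 :=
    Literature.NumberTheory.QuadraticFields.Quadratic.torsionOrder_eq_two_of_discr_lt_neg_four hK.1 hd4
  have h2N : (2 : ℕ) ∣ W.conductorNorm ℤ := dvd_trans (dvd_pow_self 2 two_ne_zero) h4N
  have hsplit : SplitsIn K 2 := hHN 2 Nat.prime_two h2N
  ------------------------------------------------------------------ the Heegner point, non-torsion, Kolyvagin
  obtain ⟨P, Dt, H, ι, hP⟩ := hHP W K hK hHN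
  have hL0 : W.entireLFunction 1 = 0 := entireLFunction_one_eq_zero_of_analyticRank_eq_one hr
  obtain ⟨-, hderiv⟩ := leadingLCoeff_eq_deriv_of_analyticRank_eq_one hr
  have hLK : LDerivEK W K ≠ 0 := by
    rw [lDerivEK_eq_deriv_mul W K hmod hL0]; exact mul_ne_zero hderiv hLt
  have hnt : ¬ IsOfFinAddOrder P :=
    (lDerivEK_ne_zero_iff_not_isOfFinAddOrder W (W.conductorNorm ℤ) K (hGZ _ W K) hK hHN ⟨Dt, H, ι, hP⟩).mp hLK
  have hKoK : Literature.NumberTheory.EllipticCurves.kolyvagin (W.conductorNorm ℤ) W K := hKo _ W K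
  obtain ⟨hrk, hfinK⟩ := hKoK hK hHN ⟨Dt, H, ι, hP⟩ hnt
  haveI : Finite (W.baseChange K).sha := hfinK
  have hc0 : Dt.c ≠ 0 := Dt.maninConstant_ne_zero_holds
  ------------------------------------------------------------------ the anticyclotomic frame data at `2`
  obtain ⟨κ, γ, -, hκ, hγ, -⟩ := X11b.exists_anticyclotomic_generator_prime (p := 2) hK
  haveI : Fact (κ.IsTopGenerator γ) := ⟨hγ⟩
  obtain ⟨𝔭, h𝔭, he, hf⟩ := X11b.exists_degreeOnePrime_of_splitsIn K 2 hK.1 hsplit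
  obtain ⟨𝔭', hne, h𝔭', he', hf'⟩ := X11b.Three.exists_ne_degreeOne_prime hK.1 h𝔭 he hf
  obtain ⟨ι₀⟩ := PadicAlgCl.nonempty_ringEquiv_complex 2
  obtain ⟨ι', -, hind⟩ := exists_datum_forall_mem_iff 2 ι₀ hK h𝔭
  ------------------------------------------------------------------ `τ = 0` control FIRST (it carries torsion), halved frame, halved IMC equality
  obtain ⟨n, hn, hnf⟩ := hCtl₀ (W.conductorNorm ℤ) K Dt H ι P rfl hK hHN hLt hP hnt hKoK κ hκ γ 𝔭' h𝔭' he' hf'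
  have htors : Module.IsTorsion (IwasawaAlgebra 2) (XAc (W.baseChange K) 2 κ 𝔭' ∅ γ) := hn.1
  obtain ⟨ΩK, Ωp, Qh, hΩK, hΩp, hQ⟩ := hFr (W.conductorNorm ℤ) K Dt rfl hK hHN κ hκ γ 𝔭 h𝔭 he hf ι' hind
  have hEq₁ : (XAc.charIdeal (W.baseChange K) 2 κ 𝔭' ∅ γ).map (PowerSeries.map (R1.toCpInt 2)) = Ideal.span {Qh} :=
    hEq (W.conductorNorm ℤ) K Dt rfl hK hHN κ hκ γ 𝔭 h𝔭 he hf 𝔭' h𝔭' hne ι' hind ΩK Ωp Qh hΩK hΩp hQ htors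
  -- the socket's split Tamagawa product is the full one over a Heegner field
  rw [X11b.padicValNat_tamagawaProductSplit_eq_of_heegner_prime W K 2 rfl hHN] at hnf
  ------------------------------------------------------------------ CORE♭: `n = 2·padicLogOrd − 2·ord₂ c`
  have hcore := charExponent_eq_of_halvedIMCEq_two hL W K κ γ Dt H ι P rfl h4N hK hd4 hHN hκ hP hnt hrk 𝔭 h𝔭 he hf 𝔭' h𝔭' he'
    hf' ι' hind hΩK hΩp hQ hn hEq₁
  ------------------------------------------------------------------ the `K`-side identity `ord₂ (4 I²/(c² w² c_K)) = ord₂ #Ш(E_K)`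
  set I : ℕ := (AddSubgroup.zmultiples P).index with hI_def
  have hheight := Summit.BirchSwinnertonDyer.Rank1Residual.P2.torsionOrder_sq_mul_canonicalHeight_eq_index_sq_mul_regulator
    (W.baseChange K) hrk P hnt
  have htK : 0 < (W.baseChange K).torsionOrder := (W.baseChange K).torsionOrder_pos_holds
  have hI0 : I ≠ 0 := by
    intro hI
    rw [← hI_def, hI] at hheight
    have h0 : ((W.baseChange K).torsionOrder : ℝ) ^ 2 * P.canonicalHeight = 0 := by rw [hheight]; simp
    rcases mul_eq_zero.mp h0 with h' | h'
    · exact absurd ((pow_eq_zero_iff two_ne_zero).mp h') (by exact_mod_cast htK.ne')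
    · exact hnt ((Affine.Point.canonicalHeight_eq_zero_iff_holds P).mp h')
  have hcK : 0 < (W.baseChange K).tamagawaProduct := (W.baseChange K).tamagawaProduct_pos_holds
  have hIQ : (I : ℚ) ≠ 0 := by exact_mod_cast hI0
  have hcQ : (Dt.c : ℚ) ≠ 0 := by exact_mod_cast hc0
  have hwQ : (Units.torsionOrder K : ℚ) ≠ 0 := by rw [hw2]; norm_num
  have hcKQ : ((W.baseChange K).tamagawaProduct : ℚ) ≠ 0 := by exact_mod_cast hcK.ne'
  have hsha : padicValNat 2 (Nat.card (AddCommGroup.primaryComponent (W.baseChange K).sha 2)) =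
      padicValNat 2 (W.baseChange K).shaOrder :=
    Literature.NumberTheory.EllipticCurves.padicValNat_card_addPrimaryComponent 2
  have hcval : padicValRat 2 (Dt.c : ℚ) = (padicValNat 2 Dt.c.natAbs : ℤ) := by
    rw [padicValRat.of_int]; rfl
  have h2val : padicValRat 2 (((2 : ℕ) : ℚ)) = 1 := by
    rw [padicValRat.of_nat, padicValNat_self]; rfl
  have h4val : padicValRat 2 (4 : ℚ) = 2 := by
    rw [show (4 : ℚ) = ((2 : ℕ) : ℚ) ^ 2 by norm_num, padicValRat.pow, h2val]; norm_num
  have hLHS : padicValRat 2 (4 * (I : ℚ) ^ 2 / ((Dt.c : ℚ) ^ 2 * (Units.torsionOrder K : ℚ) ^ 2 *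
      ((W.baseChange K).tamagawaProduct : ℚ))) =
      2 + 2 * (padicValNat 2 I : ℤ) - (2 * (padicValNat 2 Dt.c.natAbs : ℤ) + 2 * 1 +
        (padicValNat 2 (W.baseChange K).tamagawaProduct : ℤ)) := by
    rw [padicValRat.div (mul_ne_zero (by norm_num) (pow_ne_zero 2 hIQ))
        (mul_ne_zero (mul_ne_zero (pow_ne_zero 2 hcQ) (pow_ne_zero 2 hwQ)) hcKQ),
      padicValRat.mul (by norm_num) (pow_ne_zero 2 hIQ), padicValRat.mul (mul_ne_zero (pow_ne_zero 2 hcQ) (pow_ne_zero 2 hwQ)) hcKQ,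
      padicValRat.mul (pow_ne_zero 2 hcQ) (pow_ne_zero 2 hwQ), padicValRat.pow, padicValRat.pow, padicValRat.pow, h4val, hw2, hcval,
      h2val, padicValRat.of_nat, padicValRat.of_nat]
    push_cast
    ring
  have hv : padicValRat 2 (4 * (I : ℚ) ^ 2 / ((Dt.c : ℚ) ^ 2 * (Units.torsionOrder K : ℚ) ^ 2 *
      ((W.baseChange K).tamagawaProduct : ℚ))) = padicValNat 2 (W.baseChange K).shaOrder := by
    rw [hLHS, ← hsha]
    linarith [hcore, hnf]
  ------------------------------------------------------------------ P2's over-`K` descent (Milne) and the twin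
  have h2 : Module.finrank ℚ K = 2 := hK.1
  haveI : (W.baseChange K).IsGloballyMinimal := W.isGloballyMinimal_baseChange_of_satisfiesHeegnerHypothesis K h2 hHN
  have hD0 : (NumberField.discr K : ℚ) ≠ 0 := by exact_mod_cast NumberField.discr_ne_zero K
  haveI hEt : (W.quadraticTwist (NumberField.discr K : ℚ)).IsElliptic := W.isElliptic_quadraticTwist hD0
  have hrK : (W.baseChange K).analyticRank = 1 :=
    (Summit.BirchSwinnertonDyer.Rank1Residual.P2.analyticRank_baseChange_eq_one_iff W K hmod h2).mpr
      (Or.inl ⟨hr, ((W.quadraticTwist (NumberField.discr K : ℚ)).analyticRank_eq_zero_iff_holds (hmod _)).mpr hLt⟩)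
  obtain ⟨Cd, hCd⟩ := hasGlobalMinimalModel_rat_holds (W.quadraticTwist (NumberField.discr K : ℚ))
  haveI : (Cd • W.quadraticTwist (NumberField.discr K : ℚ)).IsGloballyMinimal := hCd
  have hWd : BSDp (Cd • W.quadraticTwist (NumberField.discr K : ℚ)) 2 :=
    hTw (W.conductorNorm ℤ) K (Cd • W.quadraticTwist (NumberField.discr K : ℚ)) rfl hK hHN ⟨Cd, rfl⟩ hLt
  exact (Summit.BirchSwinnertonDyer.Rank1Residual.P2.bsdp_iff_bsdp_twist_of_heegnerIndexOverK W 2 K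
    (Cd • W.quadraticTwist (NumberField.discr K : ℚ)) (W.conductorNorm ℤ) Dt H ι P (hGZ _ W K) hKoK hGZK hmod hMilne hK hHN hP hc0
    hrK ⟨Cd, rfl⟩ hv).mpr hWd

/-! ### §6 The class-wide form without a torsion stub -/

/-- **`descent_two_of_socket` — the class-wide `τ = 0` descent WITHOUT a torsion stub (reshape B, five stubs).** As
`descent_two_of_controlZero`, with the torsion hypothesis dropped (supplied by the socket, §5): granted «PRINTS(2)», Milne and the class-wide socket
`hD2a₀`, for `W` in the class: HALVED frames ∧ HALVED ♭-IMC equality (torsion as its own antecedent) ∧ twin `BSD₂` ⟹ `BSDp W 2`.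
[cite: Milne1972ArithmeticAV, §1 Thm. 1] [cite: JetchevSkinnerWan2017, Thm. 3.3.1 (shape)] [cite: Ogg1966, main theorem (CM curves are not semistable at bad primes)] -/
theorem descent_two_of_socket (hMilne : Milne1972.bsdQuotient_baseChange_quadratic)
    (hD2a₀ : ∀ (W : WeierstrassCurve ℚ) [W.IsElliptic] [W.IsGloballyMinimal],
      W.HasCM → W.analyticRank = 1 → CMSplit W 2 → ¬ Good W 2 →
      ∀ (N : ℕ) [NeZero N] (K : Type) [Field K] [NumberField K] (Dt : ModularParametrizationData W N)
        (H : HeegnerDatum N (NumberField.discr K)) (ι : K →+* ℂ) (P : (W.baseChange K).toAffine.Point),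
        W.conductorNorm ℤ = N → IsImaginaryQuadratic K → SatisfiesHeegnerHypothesis N K →
        (W.quadraticTwist (NumberField.discr K : ℚ)).entireLFunction 1 ≠ 0 →
        WeierstrassCurve.Affine.Point.map ι.toRatAlgHom P = heegnerPointComplex Dt H → ¬ IsOfFinAddOrder P →
        Literature.NumberTheory.EllipticCurves.kolyvagin N W K →
        ∀ (κ : ZpExtension K 2), κ.IsAnticyclotomic → ∀ (γ : Field.absoluteGaloisGroup K) [Fact (κ.IsTopGenerator γ)]
          (𝔭 : HeightOneSpectrum (𝓞 K)) (h𝔭 : ((2 : ℕ) : 𝓞 K) ∈ 𝔭.asIdeal) (he : 𝔭.asIdeal.ramificationIdx (𝓞 ℚ) = 1)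
          (hf : 𝔭.asIdeal.inertiaDeg (𝓞 ℚ) = 1),
          SchneiderFree.AdditiveControlOnTreeAt 2 κ 𝔭 γ (embAt K 2 𝔭 h𝔭 he hf) P) :
    (ToricPublishedInputs ∧
      LiuZhangZhang2018.thm151_thm153_modularCurve_heegnerVector_additive ∧
      bsdTriple_of_hasCM_of_L_one_ne_zero ∧
      (∀ (K : Type) [Field K] [NumberField K], poitouTate_selmerStructure_duality K) ∧
      (∀ (K : Type) [Field K] [NumberField K], poitouTate_sha_tateDual K) ∧
      (∀ (K : Type) [Field K] [NumberField K] (v : HeightOneSpectrum (𝓞 K)),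
        localEulerPoincareCharacteristic (v.adicCompletion K)) ∧
      fieldCdLE_two_of_numberField ∧
      (∀ (K : Type) [Field K] [NumberField K] (p : ℕ) [Fact p.Prime],
        ZpExtension.decomp_not_le_kerSubgroup_of_isAnticyclotomic K p)) →
    ∀ (W : WeierstrassCurve ℚ) [W.IsElliptic] [W.IsGloballyMinimal],
      W.HasCM → W.analyticRank = 1 → CMSplit W 2 → ¬ Good W 2 →
      (∀ (N : ℕ) [NeZero N] (K : Type) [Field K] [NumberField K] (Dt : ModularParametrizationData W N),
        W.conductorNorm ℤ = N → IsImaginaryQuadratic K → SatisfiesHeegnerHypothesis N K →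
        ∀ (κ : ZpExtension K 2), κ.IsAnticyclotomic → ∀ (γ : Field.absoluteGaloisGroup K) [Fact (κ.IsTopGenerator γ)]
          (𝔭 : HeightOneSpectrum (𝓞 K)), ((2 : ℕ) : 𝓞 K) ∈ 𝔭.asIdeal → 𝔭.asIdeal.ramificationIdx (𝓞 ℚ) = 1 →
          𝔭.asIdeal.inertiaDeg (𝓞 ℚ) = 1 → ∀ (ι' : PadicAlgCl 2 ≃+* ℂ), SchneiderFree.BranchInducesPrime 2 ι' 𝔭 →
          ∃ (ΩK : ℂ) (Ωp : ℂ_[2]) (Qh : PowerSeries (PadicComplexInt 2)),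
            ΩK ≠ 0 ∧ Ωp ≠ 0 ∧ R1.IsBDPLFunctionInt 2 ι' 𝔭 κ γ Dt.f ΩK Ωp (2 * Qh)) →
      (∀ (N : ℕ) [NeZero N] (K : Type) [Field K] [NumberField K] (Dt : ModularParametrizationData W N),
        W.conductorNorm ℤ = N → IsImaginaryQuadratic K → SatisfiesHeegnerHypothesis N K →
        ∀ (κ : ZpExtension K 2), κ.IsAnticyclotomic → ∀ (γ : Field.absoluteGaloisGroup K) [Fact (κ.IsTopGenerator γ)]
          (𝔭 : HeightOneSpectrum (𝓞 K)), ((2 : ℕ) : 𝓞 K) ∈ 𝔭.asIdeal → 𝔭.asIdeal.ramificationIdx (𝓞 ℚ) = 1 →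
          𝔭.asIdeal.inertiaDeg (𝓞 ℚ) = 1 → ∀ (𝔭' : HeightOneSpectrum (𝓞 K)), ((2 : ℕ) : 𝓞 K) ∈ 𝔭'.asIdeal → 𝔭' ≠ 𝔭 →
          ∀ (ι' : PadicAlgCl 2 ≃+* ℂ), SchneiderFree.BranchInducesPrime 2 ι' 𝔭 →
          ∀ (ΩK : ℂ) (Ωp : ℂ_[2]) (Qh : PowerSeries (PadicComplexInt 2)), ΩK ≠ 0 → Ωp ≠ 0 →
            R1.IsBDPLFunctionInt 2 ι' 𝔭 κ γ Dt.f ΩK Ωp (2 * Qh) →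
            Module.IsTorsion (IwasawaAlgebra 2) (XAc (W.baseChange K) 2 κ 𝔭' ∅ γ) →
            (XAc.charIdeal (W.baseChange K) 2 κ 𝔭' ∅ γ).map (PowerSeries.map (R1.toCpInt 2)) = Ideal.span {Qh}) →
      (∀ (N : ℕ) [NeZero N] (K : Type) [Field K] [NumberField K]
        (Wd : WeierstrassCurve ℚ) [Wd.IsElliptic] [Wd.IsGloballyMinimal],
        W.conductorNorm ℤ = N → IsImaginaryQuadratic K → SatisfiesHeegnerHypothesis N K →
        (∃ C : VariableChange ℚ, C • W.quadraticTwist (NumberField.discr K : ℚ) = Wd) →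
        (W.quadraticTwist (NumberField.discr K : ℚ)).entireLFunction 1 ≠ 0 → BSDp Wd 2) →
      BSDp W 2 := by
  intro h0 W _ _ hCM hr hsplit hng hFr hEq hTw
  obtain ⟨hF, hL, -, -, -, -, -, -⟩ := h0
  -- `W` is additive at `2` (CM ⟹ not multiplicative), hence `4 ∣ N_W`
  have h4N : 2 ^ 2 ∣ W.conductorNorm ℤ := by
    by_contra h
    rcases hasGoodReductionAtPrime_or_hasMultiplicativeReductionAtPrime_of_not_sq_dvd_conductorNorm (V := W) h with hg | hm
    · exact hng hg
    · exact Literature.NumberTheory.EllipticCurves.Rank1Residual.not_mult_of_hasCM (W := W) hCM 2 hm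
  exact bsdp_two_of_halvedIMCEq_of_socket_of_twist hF hL hMilne W h4N hr hFr hEq hTw (hD2a₀ W hCM hr hsplit hng)

end Summit.BirchSwinnertonDyer.BirchSwinnertonDyer.Theorems.PrintCf2.EisensteinTwo

end
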